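import Mathlib
import Summits.Ventures.PercRepro2.SwOutJunctionH1Claw
import Summits.Ventures.PercRepro2.SwOutCrossJunctionExample
import Summits.Ventures.PercRepro2.SwOutCrossJunctionMarkRegion

/-!
# Theorem A (the (H1) junction, g14) on the cross-junction instance with the mark at a dropped
vertex (blind cell PercRepro2, night-4 g27, 2026-08-28; proofs/NIGHT4-G27.md §13)

A test of subsumption, prompted by the coverage census (mining/night-4/g27/coverage.py: the base
families of g10/g11/g14 alone cover exactly the pairs the cross-junction family covers at n ≤ 7).
The simple-arm hypothesis (H1) of g14 — every neighbour of `u` is adjacent to `h` or lies in a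
component of `G[U ∖ {h, u}]` with no neighbour of `h` — holds at a cross junction without pieces:
the dropped vertices form such components whatever their cross edges.  So g14's
`sw_of_junctionH1`, which exempts the mark from `hout` wherever it lies, gives row (SW) on
`crossEx` with the mark at the dropped vertex `4` directly (**`sw_crossExQ_viaH1`**) — the
statement of g26's `sw_crossExQ`, without the cross-junction chain and without the outside edge
of the mark.  `compU_subset` generalises g14's `compU_subset_singleton` to any closed set.  IN GENERAL:
**`CrossJunctionM.H1`** — every cross junction with the mark anywhere (g24–g27's structures
`CrossJunction`, `CrossJunctionU`, `CrossJunctionQ` through `CrossJunctionM`) satisfies (H1), since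
a dropped vertex's component consists of dropped vertices (`hp_in`), none adjacent to `h`
(`hnadj_p`) — so **`CrossJunctionM.reducible_viaH1`** / **`sw_of_crossJunctionM_viaH1`**: the
class statement and rows (SW) / 2′SW-ALL of the whole cross-junction row of record are
corollaries of g14's Theorem A.  The cross-junction chain (g23–g27) is therefore a second proof
of a special case of Theorem A (with its explicit injections), not new coverage — exactly what
the coverage census measures (the base families B2 / B3 alone: 124,513 of 219,240 pairs at
n = 7, the same count as with the cross junction).
-/

namespace Summit.Ventures.PercRepro2

namespace LocRows

open Hull

variable {V : Type*} {E : Type*} [Fintype E] [DecidableEq E]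

open scoped Classical

variable {ends : E → Sym2 V}

omit [Fintype E] [DecidableEq E] in
/-- A component of `G[U ∖ {h, u}]` lies in any set containing its root and closed under the
edges inside `U ∖ {h, u}`. -/
lemma compU_subset {U : Set V} {h u p : V} {S : Set V} (hpS : p ∈ S)
    (hS : ∀ e x y, ends e = s(x, y) → x ∈ S → y ∈ U \ {h, u} → y ∈ S) :
    compU ends U h u p ⊆ S := by
  intro v hv
  refine mem_of_conn_of_closed (ends := ends) (S := S) ?_ hpS hv
  intro a ha b hab
  obtain ⟨_, e, he, hends⟩ := openGraph_adj.1 hab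
  have he' : e ∈ within ends (U \ {h, u}) := by simpa using he
  obtain ⟨x, hx, y, hy, hxy⟩ := he'
  rw [hends, Sym2.eq_iff] at hxy
  rcases hxy with ⟨-, h2⟩ | ⟨-, h2⟩
  · exact hS e a b hends ha (by rw [h2]; exact hy)
  · exact hS e a b hends ha (by rw [h2]; exact hx)

end LocRows

namespace CrossArm

open Hull LocRows

open scoped Classical

/-- (H1) holds at the cross junction `crossEx` (`u = 3`): the neighbour `6` is adjacent to `h`,
the neighbours `4`, `5` lie in the component `{4, 5}` of `G[U ∖ {h, u}]`, which has no neighbour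
of `h`. -/
theorem crossEx_H1 : H1 crossEx ({0}ᶜ) 1 3 := by
  intro e p hep
  have hcomp : ∀ p ∈ ({4, 5} : Set (Fin 7)), ∀ q ∈ compU crossEx ({0}ᶜ) 1 3 p,
      ∀ e', crossEx e' ≠ s(1, q) := by
    intro p hp q hq e' he'
    have hq' : q ∈ ({4, 5} : Set (Fin 7)) := by
      refine compU_subset hp ?_ hq
      intro e x y hexy hx hy
      simp only [Set.mem_insert_iff, Set.mem_singleton_iff] at hx ⊢
      simp only [Set.mem_sdiff, Set.mem_compl_iff, Set.mem_singleton_iff, Set.mem_insert_iff,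
        not_or] at hy
      revert hexy hx hy; revert e x y
      decide
    simp only [Set.mem_insert_iff, Set.mem_singleton_iff] at hq'
    rcases hq' with rfl | rfl <;> revert he' <;> revert e' <;> decide
  fin_cases e
  · exfalso; simp only [crossEx, Sym2.eq_iff] at hep; omega
  · have hp : p = 6 := by simp only [crossEx, Sym2.eq_iff] at hep; omega
    subst hp
    exact Or.inl ⟨0, by decide⟩
  · have hp : p = 4 := by simp only [crossEx, Sym2.eq_iff] at hep; omega
    subst hp
    exact Or.inr (hcomp 4 (by simp))
  · have hp : p = 5 := by simp only [crossEx, Sym2.eq_iff] at hep; omega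
    subst hp
    exact Or.inr (hcomp 5 (by simp))
  all_goals
    exfalso
    simp only [crossEx, Sym2.eq_iff] at hep
    omega

/-- **Row (SW) on `crossEx` with the mark at the dropped vertex `4`, by g14's Theorem A** — the
statement of g26's `sw_crossExQ`, from the (H1) junction theorem alone. -/
theorem sw_crossExQ_viaH1 : Sw crossEx 0 1 4 := by
  refine sw_of_junctionH1 (l := 0) (h := 1) (o := 4) (u := 3) (by decide) ?_ ?_ (by decide) ?_
    crossEx_H1 ?_
  · intro e; fin_cases e <;> decide
  · intro e; fin_cases e <;> decide
  · intro e; fin_cases e <;> decide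
  · intro x hx0 hx1 hx2 hx3
    fin_cases x
    · exact absurd rfl hx0
    · exact absurd rfl hx1
    · exact ⟨8, rfl⟩
    · exact absurd rfl hx3
    · exact absurd rfl hx2
    · exact ⟨7, rfl⟩
    · exact ⟨5, rfl⟩

/-- The same with the mark at the junction `3` (g26's `sw_of_crossJunctionU` case). -/
theorem sw_crossExU_viaH1 : Sw crossEx 0 1 3 := by
  refine sw_of_junctionH1 (l := 0) (h := 1) (o := 3) (u := 3) (by decide) ?_ ?_ (by decide) ?_
    crossEx_H1 ?_
  · intro e; fin_cases e <;> decide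
  · intro e; fin_cases e <;> decide
  · intro e; fin_cases e <;> decide
  · intro x hx0 hx1 hx2 hx3
    fin_cases x
    · exact absurd rfl hx0
    · exact absurd rfl hx1
    · exact ⟨8, rfl⟩
    · exact absurd rfl hx3
    · exact ⟨6, rfl⟩
    · exact ⟨7, rfl⟩
    · exact ⟨5, rfl⟩

section General

variable {V : Type*} {E : Type*} [Fintype E] [DecidableEq E]

open scoped Classical

variable {ends : E → Sym2 V} {X : Type*} {U : Set V} {h u o : V} {p : X → V} {G : SimpleGraph X}

omit [Fintype E] [DecidableEq E] in
/-- **Every cross junction with the mark anywhere satisfies (H1)**: a neighbour of `u` is adjacent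
to `h` or a dropped vertex, whose component in `G[U ∖ {h, u}]` consists of dropped vertices, none
adjacent to `h`. -/
theorem CrossJunctionM.H1 (hj : CrossJunctionM ends U h u p G o) : LocRows.H1 ends U h u := by
  intro e x hex
  by_cases hxp : ∀ i, x ≠ p i
  · left
    exact hj.hu_adj_h e x hex hxp
  · right
    obtain ⟨i, hi⟩ : ∃ i, x = p i := by
      by_contra hne
      exact hxp fun i h' => hne ⟨i, h'⟩
    subst hi
    intro q hq e' he'
    have hsub : compU ends U h u (p i) ⊆ Set.range p := by
      refine compU_subset ⟨i, rfl⟩ ?_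
      rintro e'' _ y hey ⟨j, rfl⟩ hy
      rcases hj.hp_in j e'' y hey hy.1 with rfl | ⟨k, rfl⟩
      · exact absurd (Or.inr rfl) hy.2
      · exact ⟨k, rfl⟩
    obtain ⟨j, rfl⟩ := hsub hq
    exact hj.hnadj_p j e' he'

/-- **A cross-junction region with the mark anywhere is a base region of the series reduction,
by g14's Theorem A** (`reducible_of_junctionH1`): the second proof of `CrossJunctionM.reducible`. -/
theorem CrossJunctionM.reducible_viaH1 (hj : CrossJunctionM ends U h u p G o) {l : V}
    (hl : l ∉ U) : Reducible l h o ends U :=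
  reducible_of_junctionH1 hl hj.hloop_h hj.hloop_u hj.hne_hu hj.hnadj hj.hout hj.H1

/-- **Row 2′SW-ALL on every graph with a cross junction whose mark is any vertex other than `h`,
by g14's Theorem A** — the statement of `swAll_of_crossJunctionM` as a corollary of
`reducible_of_junctionH1`. -/
theorem swAll_of_crossJunctionM_viaH1 {l : V} (hlh : l ≠ h)
    (hj : CrossJunctionM ends ({l}ᶜ) h u p G o) : SwAll ends l h o :=
  swAll_of_reducible l h o hlh (hj.reducible_viaH1 (by simp))

/-- **Row (SW) on every graph with a cross junction whose mark is any vertex other than `h`, by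
g14's Theorem A.** -/
theorem sw_of_crossJunctionM_viaH1 {l : V} (hlh : l ≠ h)
    (hj : CrossJunctionM ends ({l}ᶜ) h u p G o) : Sw ends l h o :=
  sw_of_swAll ends (swAll_of_crossJunctionM_viaH1 hlh hj)

end General

end CrossArm

end Summit.Ventures.PercRepro2
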